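import Mathlib.MeasureTheory.Measure.GiryMonad
import Literature.Analysis.FunctionSpaces.PointConfigKernel
import HarnessLib

/-!
# Factorial measures and factorial moment (correlation) measures of laws on configurations

Topic `Literature/Analysis/FunctionSpaces` (next to `PoissonPointProcess`, `PointConfigKernel`);
namespace `Literature.Analysis.FunctionSpaces.PointConfig`. Serves the definition request
`defn-StationaryLanfordState` (`Literature/MathematicalPhysics/KineticTheory/StationaryLanfordState.lean`:
rescaled correlation functions and cumulants of laws on infinite hard-sphere configurations) and
any point-process statement needing higher (factorial) moment measures — Mathlib has no point
processes / random measures.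

For a locally finite simple configuration `ω : PointConfig E` and `k : ℕ`:

* `ω.tuples k` — the `k`-tuples `p : Fin k → E` of DISTINCT points of `ω`;
* `ω.factorialMeasure k` — the `k`-th factorial measure `ω^{(k)} = ∑^{≠} δ_{(x_{i₁},…,x_{i_k})}`
  (Last–Penrose 2017 (4.4)–(4.5)), as `Measure.count.restrict (ω.tuples k)` on `Fin k → E` (for
  `k = 1`: the counting measure `ω.toMeasure` of `PointConfigKernel` along `Fin 1 → E ≃ E`);
  `factorialMeasure_apply` (`ω^{(k)}(A)` = number of `k`-tuples of distinct points in `A`),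
  `lintegral_factorialMeasure` (integration = summation over tuples);
* `measurable_factorialMeasure` — `ω ↦ ω^{(k)}` is measurable for the count σ-algebra
  (Last–Penrose Prop. 4.3), PROVED by induction on `k` from the recursion `tsum_tuples_succ` (sum
  over the first point, then over the `k`-tuples avoiding it — the Dirac-sum form of their
  Lemma 4.2) and Campbell measurability `PointConfig.measurable_tsum_carrier`, run over the
  parameter spaces `PointConfig E × (Fin j → E)`, which are stable under adjoining a point
  (`measurable_tsum_tuples_param`, `measurable_tsum_tuples`);
* `PointConfig.corrMeasure ν k` — the `k`-th FACTORIAL MOMENT MEASURE (correlation measure)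
  `α_k(A) = E_ν[ω^{(k)}(A)]` of a law `ν` on configurations (Last–Penrose Def. 4.9 (4.22)), Mathlib's
  `Measure.bind ν (factorialMeasure k)`; `corrMeasure_apply`, and the Campbell formula
  `lintegral_corrMeasure`: `∫ g dα_k = E_ν[∑^{≠} g]` ((4.23); Spohn 1991 (2.12)–(2.13): the densities
  of the `α_k` with respect to Lebesgue measure are the correlation functions `ρ_k`).

## Design choices

* Tuples are ORDERED (`Fin k → E`), as in (4.4): for a symmetric set `α_k` counts each unordered
  `k`-point subset `k!` times, and densities are the usual symmetric correlation functions, with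
  `α_k(B^k) = E[N_B (N_B - 1) ⋯ (N_B - k + 1)]` ((4.7)).
* The measurability results assume a second-countable Hausdorff σ-compact `E` whose open sets are
  measurable: the diagonal must be measurable (`MeasurableEq E`, automatic) and configurations
  countable. Phase spaces `ℝ^d × ℝ^d` qualify.
* Deliberately NOT here: (non-factorial) moment measures and Janossy measures, existence of
  densities (Radon–Nikodym is applied downstream, under a dominating bound), and the
  determination of a law by its factorial moment measures (Last–Penrose Prop. 4.12).

## References

* G. Last, M. Penrose, *Lectures on the Poisson Process*, CUP (2017), §4.2 (4.4)–(4.7),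
  Lemma 4.2, Prop. 4.3; §4.4 Def. 4.9 (4.22)–(4.23) (held: PDF pp. 38–39, 43). [LastPenrose2017]
* H. Spohn, *Large Scale Dynamics of Interacting Particles* (1991), Part I §2.1 (2.10)–(2.14)
  (held: PDF pp. 23–24). [Spohn1991]
-/

noncomputable section

open MeasureTheory Set Filter Function
open scoped ENNReal

namespace Literature.Analysis.FunctionSpaces

/-! ## Factorial measures and factorial moment (correlation) measures of laws on configurations -/

namespace PointConfig

section Factorial

variable {E : Type*} [TopologicalSpace E]

/-- The `k`-TUPLES OF DISTINCT POINTS of the configuration `ω`: injective `p : Fin k → E` with all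
entries in `ω` (the index set of the sum `∑^{≠}_{i₁,…,i_k}` in Last–Penrose (4.4); Spohn 1991
(2.12): "distinct `n`-tuples"). [cite: LastPenrose2017, §4.2 (4.4)] -/
def tuples (k : ℕ) (ω : PointConfig E) : Set (Fin k → E) :=
  {p | Function.Injective p ∧ ∀ i, p i ∈ ω}

/-- Membership in `tuples`. [folklore] -/
theorem mem_tuples {k : ℕ} {ω : PointConfig E} {p : Fin k → E} :
    p ∈ tuples k ω ↔ Function.Injective p ∧ ∀ i, p i ∈ ω :=
  Iff.rfl

/-- Every `0`-tuple is a tuple of distinct points (there is exactly one). [folklore] -/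
@[simp]
theorem tuples_zero (ω : PointConfig E) : tuples 0 ω = univ :=
  eq_univ_of_forall fun _ => ⟨fun i => i.elim0, fun i => i.elim0⟩

/-- `Fin.cons x q` is a `(k+1)`-tuple of distinct points of `ω` iff `x ∈ ω` is not an entry of the
`k`-tuple `q` of distinct points of `ω`. [folklore] -/
theorem cons_mem_tuples_iff {k : ℕ} {ω : PointConfig E} {x : E} {q : Fin k → E} :
    (Fin.cons x q : Fin (k + 1) → E) ∈ tuples (k + 1) ω ↔
      x ∈ ω ∧ x ∉ Set.range q ∧ q ∈ tuples k ω := by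
  rw [mem_tuples, Fin.cons_injective_iff, Fin.forall_fin_succ, mem_tuples]
  simp only [Fin.cons_zero, Fin.cons_succ]
  tauto

/-- The tuples of distinct points of a configuration in a σ-compact space form a countable set
(a configuration is countable, `PointConfig.countable_carrier`). [folklore] -/
theorem countable_tuples [SigmaCompactSpace E] (k : ℕ) (ω : PointConfig E) :
    (tuples k ω).Countable := by
  haveI : Countable (ω : Set E) := ω.countable_carrier.to_subtype
  have h : tuples k ω ⊆ Set.range fun q : Fin k → (ω : Set E) => fun i => (q i : E) := by
    intro p hp
    exact ⟨fun i => ⟨p i, hp.2 i⟩, rfl⟩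
  exact (Set.countable_range _).mono h

open Classical in
/-- **Recursion for sums over tuples of distinct points** (the Dirac-sum form of Last–Penrose
Lemma 4.2): a sum over `(k+1)`-tuples of distinct points of `ω` is a sum over a first point
`x ∈ ω` and a `k`-tuple of distinct points avoiding `x`. [cite: LastPenrose2017, Lemma 4.2] -/
theorem tsum_tuples_succ (k : ℕ) (ω : PointConfig E) (g : (Fin (k + 1) → E) → ℝ≥0∞) :
    ∑' p : tuples (k + 1) ω, g p =
      ∑' x : (ω : Set E), ∑' q : tuples k ω,
        (if (x : E) ∈ Set.range (q : Fin k → E) then 0 else g (Fin.cons (x : E) q)) := by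
  -- the summand on pairs (first point, remaining tuple)
  set f : ↥(ω : Set E) × ↥(tuples k ω) → ℝ≥0∞ := fun σ =>
    if (σ.1 : E) ∈ Set.range (σ.2 : Fin k → E) then 0 else g (Fin.cons (σ.1 : E) σ.2) with hf
  -- splitting a `(k+1)`-tuple into its head and tail
  have hsplit : ∀ p : tuples (k + 1) ω, (p : Fin (k + 1) → E) 0 ∈ ω ∧
      (p : Fin (k + 1) → E) 0 ∉ Set.range (Fin.tail (p : Fin (k + 1) → E)) ∧
      Fin.tail (p : Fin (k + 1) → E) ∈ tuples k ω := fun p => by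
    have hp := p.2
    rwa [← Fin.cons_self_tail (p : Fin (k + 1) → E), cons_mem_tuples_iff] at hp
  set φ : tuples (k + 1) ω → ↥(ω : Set E) × ↥(tuples k ω) := fun p =>
    (⟨(p : Fin (k + 1) → E) 0, (hsplit p).1⟩, ⟨Fin.tail (p : Fin (k + 1) → E), (hsplit p).2.2⟩)
    with hφ
  have hφinj : Function.Injective φ := by
    intro p p' h
    simp only [hφ, Prod.mk.injEq, Subtype.mk.injEq] at h
    apply Subtype.ext
    rw [← Fin.cons_self_tail (p : Fin (k + 1) → E), ← Fin.cons_self_tail (p' : Fin (k + 1) → E),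
      h.1, h.2]
  have hsupp : Function.support f ⊆ Set.range φ := by
    rintro ⟨x, q⟩ hσ
    rw [Function.mem_support, hf] at hσ
    simp only [ne_eq, ite_eq_left_iff, not_forall, exists_prop] at hσ
    have hcons : (Fin.cons (x : E) (q : Fin k → E) : Fin (k + 1) → E) ∈ tuples (k + 1) ω :=
      cons_mem_tuples_iff.2 ⟨x.2, hσ.1, q.2⟩
    refine ⟨⟨_, hcons⟩, ?_⟩
    simp only [hφ, Fin.cons_zero, Fin.tail_cons, Subtype.coe_eta]
  have hcomp : ∀ p : tuples (k + 1) ω, f (φ p) = g p := fun p => by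
    simp only [hf, hφ, Fin.cons_self_tail]
    rw [if_neg (hsplit p).2.1]
  calc ∑' p : tuples (k + 1) ω, g p = ∑' p : tuples (k + 1) ω, f (φ p) := by simp_rw [hcomp]
    _ = ∑' σ, f σ := hφinj.tsum_eq hsupp
    _ = _ := ENNReal.tsum_prod'

variable [MeasurableSpace E]

/-- The `k`-th FACTORIAL MEASURE `ω^{(k)} = ∑^{≠}_{p ∈ ω^k} δ_p` of the configuration `ω`: counting
measure on the `k`-tuples of distinct points of `ω` (Last–Penrose (4.4)–(4.5); for `k = 1` this is
the counting measure `PointConfig.toMeasure` along `Fin 1 → E ≃ E`).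
[cite: LastPenrose2017, §4.2 (4.4)–(4.5)] -/
def factorialMeasure (k : ℕ) (ω : PointConfig E) : Measure (Fin k → E) :=
  Measure.count.restrict (tuples k ω)

/-- Unfolding lemma for `factorialMeasure`. [folklore] -/
theorem factorialMeasure_def (k : ℕ) (ω : PointConfig E) :
    factorialMeasure k ω = Measure.count.restrict (tuples k ω) :=
  rfl

variable [MeasurableSingletonClass E] [SigmaCompactSpace E]

/-- The set of `k`-tuples of distinct points of a configuration is measurable (countable).
[folklore] -/
theorem measurableSet_tuples (k : ℕ) (ω : PointConfig E) : MeasurableSet (tuples k ω) :=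
  (countable_tuples k ω).measurableSet

/-- `ω^{(k)}(A)` is the NUMBER of `k`-tuples of distinct points of `ω` lying in `A`
(Last–Penrose (4.4)). [cite: LastPenrose2017, §4.2 (4.4)] -/
theorem factorialMeasure_apply (k : ℕ) (ω : PointConfig E) {A : Set (Fin k → E)}
    (hA : MeasurableSet A) : factorialMeasure k ω A = (A ∩ tuples k ω).encard := by
  rw [factorialMeasure, Measure.restrict_apply hA,
    Measure.count_apply (hA.inter (measurableSet_tuples k ω))]

/-- Integration against `ω^{(k)}` is summation over the `k`-tuples of distinct points:
`∫ g dω^{(k)} = ∑^{≠}_{p ∈ ω^k} g(p)`. [cite: LastPenrose2017, §4.2 (4.4)] -/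
theorem lintegral_factorialMeasure (k : ℕ) (ω : PointConfig E) (g : (Fin k → E) → ℝ≥0∞) :
    ∫⁻ p, g p ∂(factorialMeasure k ω) = ∑' p : tuples k ω, g p := by
  rw [factorialMeasure, lintegral_countable g (countable_tuples k ω)]
  simp

end Factorial

section Helpers

variable {Y : Type*} [MeasurableSpace Y]

/-- Measurability of `(x, q) ↦ Fin.cons x q`. [folklore] -/
theorem measurable_finCons {α : Type*} [MeasurableSpace α] {k : ℕ} {x : α → Y} {q : α → Fin k → Y}
    (hx : Measurable x) (hq : Measurable q) :
    Measurable fun a => (Fin.cons (x a) (q a) : Fin (k + 1) → Y) := by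
  refine measurable_pi_iff.2 (Fin.cases ?_ fun i => ?_)
  · simpa only [Fin.cons_zero] using hx
  · simpa only [Fin.cons_succ] using measurable_pi_iff.1 hq i

open Classical in
/-- The avoidance indicator `(x, q) ↦ [x ∉ range q] · g(x, q)` is measurable for measurable `g`
when the diagonal of `Y` is measurable. [folklore] -/
theorem measurable_ite_mem_range [MeasurableEq Y] {α : Type*} [MeasurableSpace α] {k : ℕ}
    {x : α → Y} {q : α → Fin k → Y} {g : α → ℝ≥0∞} (hx : Measurable x) (hq : Measurable q)
    (hg : Measurable g) : Measurable fun a => if x a ∈ Set.range (q a) then 0 else g a := by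
  refine Measurable.ite ?_ measurable_const hg
  have h : {a | x a ∈ Set.range (q a)} = ⋃ i : Fin k, {a | x a = q a i} := by
    ext a
    simp only [Set.mem_setOf_eq, Set.mem_range, Set.mem_iUnion, eq_comm]
  rw [h]
  exact MeasurableSet.iUnion fun i => measurableSet_eq_fun hx (measurable_pi_iff.1 hq i)

end Helpers

section Measurability

variable {E : Type*} [TopologicalSpace E] [MeasurableSpace E] [OpensMeasurableSpace E] [T2Space E]
  [SecondCountableTopology E] [SigmaCompactSpace E]

/-- **Parametrised sums over tuples of distinct points are measurable** (induction on `k` by the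
recursion `tsum_tuples_succ` and Campbell measurability `PointConfig.measurable_tsum_carrier`;
the parameter is a configuration together with `j` marked points, a parameter space stable under
adjoining the first point of the tuple). [cite: LastPenrose2017, Prop. 4.3] -/
theorem measurable_tsum_tuples_param (k : ℕ) :
    ∀ (j : ℕ) {g : (PointConfig E × (Fin j → E)) × (Fin k → E) → ℝ≥0∞}, Measurable g →
      Measurable fun a : PointConfig E × (Fin j → E) => ∑' q : tuples k a.1, g (a, q) := by
  induction k with
  | zero =>
    intro j g hg
    have h : (fun a : PointConfig E × (Fin j → E) => ∑' q : tuples 0 a.1, g (a, q)) =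
        fun a => g (a, Fin.elim0) := by
      funext a
      have h0 : (Fin.elim0 : Fin 0 → E) ∈ tuples 0 a.1 := by simp
      rw [tsum_eq_single ⟨Fin.elim0, h0⟩]
      intro q hq
      exact absurd (Subtype.ext (Subsingleton.elim _ _)) hq
    rw [h]
    exact hg.comp (measurable_id.prodMk measurable_const)
  | succ k ih =>
    intro j g hg
    classical
    -- the summand after adjoining the first point `x = b.2 (last j)` to the parameter
    set g' : (PointConfig E × (Fin (j + 1) → E)) × (Fin k → E) → ℝ≥0∞ := fun b =>
      if b.1.2 (Fin.last j) ∈ Set.range b.2 then 0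
      else g ((b.1.1, Fin.init b.1.2), Fin.cons (b.1.2 (Fin.last j)) b.2) with hg'
    have hlast : Measurable fun b : (PointConfig E × (Fin (j + 1) → E)) × (Fin k → E) =>
        b.1.2 (Fin.last j) := (measurable_pi_apply _).comp (measurable_snd.comp measurable_fst)
    have hg'm : Measurable g' := by
      refine measurable_ite_mem_range hlast measurable_snd (hg.comp ?_)
      refine Measurable.prodMk (Measurable.prodMk (measurable_fst.comp measurable_fst) ?_)
        (measurable_finCons hlast measurable_snd)
      exact measurable_pi_lambda _ fun i =>
        measurable_pi_iff.1 (measurable_snd.comp measurable_fst) _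
    have hB := ih (j + 1) hg'm
    -- the inner sum as a jointly measurable function of (parameter, first point)
    set f : (PointConfig E × (Fin j → E)) × E → ℝ≥0∞ := fun c =>
      ∑' q : tuples k c.1.1, g' ((c.1.1, Fin.snoc c.1.2 c.2), q) with hf
    have hfm : Measurable f := by
      have hθ : Measurable fun c : (PointConfig E × (Fin j → E)) × E =>
          ((c.1.1, Fin.snoc c.1.2 c.2) : PointConfig E × (Fin (j + 1) → E)) := by
        refine Measurable.prodMk (measurable_fst.comp measurable_fst) ?_
        refine measurable_pi_iff.2 (Fin.lastCases ?_ fun i => ?_)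
        · simp only [Fin.snoc_last]
          exact measurable_snd
        · simp only [Fin.snoc_castSucc]
          exact measurable_pi_iff.1 (measurable_snd.comp measurable_fst) i
      exact hB.comp hθ
    have hsum := PointConfig.measurable_tsum_carrier (f := f) hfm
      (g := fun a : PointConfig E × (Fin j → E) => a.1) measurable_fst
    refine (congrArg Measurable (funext fun a => ?_)).mpr hsum
    calc ∑' q : tuples (k + 1) a.1, g (a, q)
        = ∑' x : (a.1 : Set E), ∑' q : tuples k a.1,
            (if (x : E) ∈ Set.range (q : Fin k → E) then 0 else g (a, Fin.cons (x : E) q)) :=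
          tsum_tuples_succ k a.1 fun p => g (a, p)
      _ = ∑' x : (a.1 : Set E), f (a, (x : E)) := tsum_congr fun x => tsum_congr fun q => by
          simp only [hg', Fin.snoc_last, Fin.init_snoc, Prod.mk.eta]

/-- **Sums over `k`-tuples of distinct points of measurable functions of (configuration, tuple)
are measurable in the configuration.** [cite: LastPenrose2017, Prop. 4.3] -/
theorem measurable_tsum_tuples {k : ℕ} {g : PointConfig E × (Fin k → E) → ℝ≥0∞}
    (hg : Measurable g) : Measurable fun ω : PointConfig E => ∑' q : tuples k ω, g (ω, q) := by
  have h := measurable_tsum_tuples_param (E := E) k 0 (g := fun b => g (b.1.1, b.2))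
    (hg.comp ((measurable_fst.comp measurable_fst).prodMk measurable_snd))
  exact h.comp (measurable_id.prodMk (measurable_const (a := Fin.elim0)))

/-- **The factorial measures depend measurably on the configuration** (Last–Penrose Prop. 4.3:
"the mappings `μ ↦ μ^{(m)}` are measurable"), for the count σ-algebra.
[cite: LastPenrose2017, Prop. 4.3] -/
theorem measurable_factorialMeasure (k : ℕ) :
    Measurable fun ω : PointConfig E => factorialMeasure k ω := by
  refine Measure.measurable_of_measurable_coe _ fun A hA => ?_
  have h : (fun ω : PointConfig E => factorialMeasure k ω A) =
      fun ω => ∑' q : tuples k ω, A.indicator 1 (q : Fin k → E) := by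
    funext ω
    rw [← lintegral_indicator_one hA, lintegral_factorialMeasure]
  rw [h]
  exact measurable_tsum_tuples ((measurable_one.indicator hA).comp measurable_snd)

/-- The `k`-th FACTORIAL MOMENT MEASURE (alias `k`-th CORRELATION MEASURE) of a law `ν` on
configurations: `α_k(A) = E_ν[ω^{(k)}(A)]`, the mean number of `k`-tuples of distinct points in
`A` (Last–Penrose Def. 4.9 (4.22); its density w.r.t. Lebesgue measure, when it exists, is the
`k`-point correlation function `ρ_k` of Spohn 1991 (2.10)–(2.13)). Mathlib's `Measure.bind` of the
measurable family `factorialMeasure k`. [cite: LastPenrose2017, Def. 4.9 (4.22)] -/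
def corrMeasure (ν : Measure (PointConfig E)) (k : ℕ) : Measure (Fin k → E) :=
  ν.bind (factorialMeasure k)

/-- `α_k(A) = E_ν[#{k-tuples of distinct points of ω in A}]` (Last–Penrose (4.22)–(4.23)).
[cite: LastPenrose2017, Def. 4.9 (4.22)–(4.23)] -/
theorem corrMeasure_apply (ν : Measure (PointConfig E)) (k : ℕ) {A : Set (Fin k → E)}
    (hA : MeasurableSet A) : corrMeasure ν k A = ∫⁻ ω, (A ∩ tuples k ω).encard ∂ν := by
  rw [corrMeasure, Measure.bind_apply hA (measurable_factorialMeasure k).aemeasurable]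
  simp_rw [factorialMeasure_apply k _ hA]

/-- **Campbell formula for correlation measures**: `∫ g dα_k = E_ν[∑^{≠}_{p ∈ ω^k} g(p)]` for
measurable `g ≥ 0` (Last–Penrose (4.23); Spohn 1991 (2.13), `⟨Σ(g_n)⟩ = ∫ g_n ρ_n`).
[cite: LastPenrose2017, Def. 4.9 (4.23)] -/
theorem lintegral_corrMeasure (ν : Measure (PointConfig E)) (k : ℕ) {g : (Fin k → E) → ℝ≥0∞}
    (hg : Measurable g) : ∫⁻ p, g p ∂(corrMeasure ν k) = ∫⁻ ω, ∑' p : tuples k ω, g p ∂ν := by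
  rw [corrMeasure, Measure.lintegral_bind (measurable_factorialMeasure k).aemeasurable
    hg.aemeasurable]
  simp_rw [lintegral_factorialMeasure]

/-- **The first factorial moment measure is the intensity measure**: `α_1(A) = E_ν[N_ω{x | (x) ∈ A}]`
along `Fin 1 → E ≃ E` (Last–Penrose, after Def. 4.9: "the first factorial moment measure of a point
process is just the intensity measure"). [cite: LastPenrose2017, Def. 4.9 (4.22)] -/
theorem corrMeasure_one_apply (ν : Measure (PointConfig E)) {A : Set (Fin 1 → E)}
    (hA : MeasurableSet A) :
    corrMeasure ν 1 A =
      ∫⁻ ω : PointConfig E, (ω.count {x | (fun _ : Fin 1 => x) ∈ A} : ℝ≥0∞) ∂ν := by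
  rw [corrMeasure_apply ν 1 hA]
  refine lintegral_congr fun ω => ?_
  have hinj : Function.Injective fun x : E => fun _ : Fin 1 => x := fun x y hxy => congrFun hxy 0
  have h : A ∩ ω.tuples 1 =
      (fun x : E => fun _ : Fin 1 => x) '' ((ω : Set E) ∩ {x | (fun _ : Fin 1 => x) ∈ A}) := by
    ext p
    have hp : (fun _ : Fin 1 => p 0) = p := funext fun i => by rw [Fin.fin_one_eq_zero i]
    constructor
    · rintro ⟨hpA, -, hpω⟩
      exact ⟨p 0, ⟨hpω 0, by rwa [Set.mem_setOf_eq, hp]⟩, hp⟩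
    · rintro ⟨x, ⟨hxω, hxA⟩, rfl⟩
      exact ⟨hxA, fun i j _ => Subsingleton.elim i j, fun _ => hxω⟩
  rw [h, hinj.injOn.encard_image, PointConfig.count]
  rfl

omit [OpensMeasurableSpace E] [T2Space E] [SecondCountableTopology E] [SigmaCompactSpace E] in

/-- The correlation measures of the zero law vanish. [folklore] -/
@[simp]
theorem corrMeasure_zero_measure (k : ℕ) : corrMeasure (0 : Measure (PointConfig E)) k = 0 := by
  rw [corrMeasure, Measure.bind_zero_left]

end Measurability

end PointConfig

end Literature.Analysis.FunctionSpaces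

end
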